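import Summits.BirchSwinnertonDyer.Rank1Residual.Additive.PotSupersingularClasses
import Summits.BirchSwinnertonDyer.Rank1Residual.O6.X3KatoMemberBoundExactCountUpper
import Literature.NumberTheory.EllipticCurves.Kato2004.MemberHullCountInputs
import Literature.NumberTheory.EllipticCurves.KatoRankBoundProofs
import Literature.NumberTheory.EllipticCurves.ShaIsogenyProofs
import HarnessLib

/-!
# Cell `bsd-potss`, routes K9 / K8-t′: on the REDUCIBLE additive potentially good rows of analytic rank 0,
# `BSD(E,p)` ⟺ ONE PINNED Λ-ADIC INDEX IDENTITY AT KATO'S MEMBER — `v_p λ(0) + ord_p #(𝐇²/X𝐇²) =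
# ord_p [H¹(ℤ[1/p],T) : Λ·ι(𝐲̄)]` for the pinned Euler-system class `𝐲` (Kato's `μ = 1` for the
# `(c,d,a(A))`-class) — and the LOWER half `L₀` ⟺ the inequality `≥`; ROUTE-FREE module

Seat `bsd-potss-kmc` generation 9, Part 16c.  With the exact count PINNED (`Kato2004.MemberCountInputs.exactCount`,
p448371: `ord Ш + v Tam + ord[A:Λιȳ] = ord q + vλ(0) + ord #(𝐇²/X𝐇²) + 2t` at Kato's member `W_K`) the
defect `ord_p #Ш_an(W_K) − ord_p #Ш(W_K)` IS the integer `m := ord[A:Λιȳ] − vλ(0) − ord #(𝐇²/X𝐇²)` (≥ 0 by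
the proved hull descent), and Cassels makes `BSD(·,p)` and its lower half class invariants.  Hence, for the
packages `P`, `C` the fact `exists_memberHullCountInputs` provides at the member:
* `missingPPartAt_iff_index_eq` : `MissingPPartAt W_K p ↔ vλ(0) + ord #(𝐇²/X𝐇²) = ord[A:Λιȳ]`;
* `missingLowerBoundAt_iff_index_le` : `MissingLowerBoundAt W_K p ↔ ord[A:Λιȳ] ≤ vλ(0) + ord #(𝐇²/X𝐇²)`;
* class form `exists_member_missingPPartAt_iff_index_eq`: for every reducible additive potentially good
  row `W` of analytic rank `0` there are Kato's member `W' ∼ W` and packages `P`, `C` at it with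
  `MissingPPartAt W p ↔ (index identity for P)` and `MissingLowerBoundAt W p ↔ (index inequality for P)`.
So the reducible rows of the L₀ cruxes (K9 19663 `WildLowerIntrinsicNonCM`'s `stub_intr_red`, KT 19618)
read, in pinned currency: «Kato's `μ` for ONE explicit Euler-system class at ONE member is `1`» — which is
what Conj. 12.10 for the class gives (Kato §14.14–Lemma 14.15) and nothing weaker gives.  CONDITIONAL on the
displayed packages / named facts; closes nothing; BSD is not advanced; Conj. 12.10 is neither stated nor used.

References: [Kato2004Asterisque] Conj. 12.10 (p. 224), §14.14–Lemma 14.15 (pp. 243–244), proof of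
Prop. 14.16 (pp. 244–245); [Cassels1965ArithmeticVIII]; [Miller2011LMS] Def. 1.1.
-/

set_option autoImplicit false
-- sibling precedent (`KatoDescentPotSupersingularAssembly.lean`): the directory name repeats the summit name
set_option linter.dupNamespace false

noncomputable section

namespace Summit.BirchSwinnertonDyer.BirchSwinnertonDyer.Theorems.ReducibleBSDOfCountInputs

open WeierstrassCurve Literature.NumberTheory.EllipticCurves
  Literature.NumberTheory.EllipticCurves.ModularForms
  Literature.NumberTheory.EllipticCurves.Kato2004
  Literature.NumberTheory.EllipticCurves.IwasawaAlgebra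
  Literature.NumberTheory.EllipticCurves.Rank1Residual
  Literature.NumberTheory.EllipticCurves.Rank1Residual.Typed
  Summit.BirchSwinnertonDyer.Rank1Residual.Additive
  Summit.BirchSwinnertonDyer.Rank1Residual

section Transport

variable (W W' : WeierstrassCurve ℚ) [W.IsElliptic] [W'.IsElliptic] [W.IsGloballyMinimal]
  [W'.IsGloballyMinimal] (p : ℕ) [Fact p.Prime]

/-- `MissingPPartAt` transports along a `ℚ`-isogeny of globally minimal curves in analytic rank `≤ 1`
(both typed halves do: `TwistComparison.missing{Lower,Upper}BoundAt_of_isIsogenous`). Bookkeeping.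
[cite: Miller2011LMS, §1 and Def. 1.1] [cite: Cassels1965ArithmeticVIII] -/
theorem missingPPartAt_of_isIsogenous (hCassels : bsdRHS_eq_of_isIsogenous)
    (hGZK : rank_eq_analyticRank_of_analyticRank_le_one) (hmod : hasEntireLFunction_rat)
    (hiso : IsIsogenous W W') (hr : W.analyticRank ≤ 1) (h : MissingPPartAt W p) :
    MissingPPartAt W' p := by
  obtain ⟨hl, hu⟩ := lower_and_upper_of_missingPPartAt W p h
  exact missingPPartAt_of_lower_of_upper W' p
    (TwistComparison.missingLowerBoundAt_of_isIsogenous W W' p hCassels hGZK hmod hiso hr hl)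
    (TwistComparison.missingUpperBoundAt_of_isIsogenous W W' p hCassels hGZK hmod hiso hr hu)

end Transport

section Member

variable {W : WeierstrassCurve ℚ} [W.IsElliptic] {p : ℕ} [Fact p.Prime]
  [ContinuousSMul ℤ_[p] (W.tateModule p)] {κ : ZpExtension ℚ p} {γ : Field.absoluteGaloisGroup ℚ}
  {I : IwasawaH1Data W p κ γ} {y : I.H} {P : MemberHullInputs W p κ γ I y}

/-- **THE DEFECT IS KATO'S INDEX DEFECT**: at a curve `W` of analytic rank `0` carrying packages `P`, `C`,
`#Ш_an(W) = q'` with `ord_p q' = ord_p #Ш(W) + (ord[A:Λιȳ] − vλ(0) − ord #(𝐇²/X𝐇²))`.  Kernel bookkeeping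
over the exact count (GZK for `Ш` finite / `Reg = 1`, modularity for `L(W,1) ≠ 0`); nothing asserted.
[cite: Kato2004Asterisque, proof of Prop. 14.16 (pp. 244–245), §14.14 (p. 243)] [cite: Miller2011LMS, Def. 1.1] -/
theorem exists_shaAn_eq_of_memberCountInputs (C : MemberCountInputs W p κ γ I y P)
    (hGZK : rank_eq_analyticRank_of_analyticRank_le_one) (hmod : hasEntireLFunction_rat)
    (hr : W.analyticRank = 0) :
    ∃ q' : ℚ, shaAn W = (q' : ℂ) ∧
      padicValRat p q' = (padicValNat p W.shaOrder : ℤ) +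
        ((padicValNat p (Nat.card (P.A ⧸ (IwasawaAlgebra p) ∙ P.ι (Submodule.Quotient.mk y))) : ℤ) -
          (((PowerSeries.constantCoeff P.lam).valuation : ℤ) +
            padicValNat p (Nat.card (coinvariants p P.H2)))) := by
  obtain ⟨q, hq, hcount⟩ := C.exactCount
  exact exists_shaAn_eq_of_exactCount W p hGZK hmod hr hq (by linarith)

/-- **`BSD(W,p)` ⟺ Kato's index identity at `W`** (`W` of analytic rank `0` carrying packages `P`, `C`):
`MissingPPartAt W p ↔ vλ(0) + ord #(𝐇²/X𝐇²) = ord[A:Λιȳ]`.  Kernel; nothing asserted.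
[cite: Kato2004Asterisque, Conj. 12.10 (p. 224), §14.14 (p. 243), proof of Prop. 14.16 (pp. 244–245)] [cite: Miller2011LMS, Def. 1.1] -/
theorem missingPPartAt_iff_index_eq (C : MemberCountInputs W p κ γ I y P)
    (hGZK : rank_eq_analyticRank_of_analyticRank_le_one) (hmod : hasEntireLFunction_rat)
    (hr : W.analyticRank = 0) :
    MissingPPartAt W p ↔
      ((PowerSeries.constantCoeff P.lam).valuation : ℤ) + padicValNat p (Nat.card (coinvariants p P.H2)) =
        padicValNat p (Nat.card (P.A ⧸ (IwasawaAlgebra p) ∙ P.ι (Submodule.Quotient.mk y))) := by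
  obtain ⟨q', hq', hv⟩ := exists_shaAn_eq_of_memberCountInputs C hGZK hmod hr
  constructor
  · rintro ⟨q'', hq'', hv''⟩
    have hqq : q'' = q' := by exact_mod_cast hq''.symm.trans hq'
    subst hqq
    rw [hv''] at hv
    linarith
  · intro h
    exact ⟨q', hq', by rw [hv]; linarith⟩

/-- **The LOWER half at `W` ⟺ Kato's index inequality `ord[A:Λιȳ] ≤ vλ(0) + ord #(𝐇²/X𝐇²)`** (the
converse of the proved hull descent).  Kernel; nothing asserted.
[cite: Kato2004Asterisque, §14.14 and Lemma 14.15 (pp. 243–244)] [cite: Miller2011LMS, Def. 1.1] -/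
theorem missingLowerBoundAt_iff_index_le (C : MemberCountInputs W p κ γ I y P)
    (hGZK : rank_eq_analyticRank_of_analyticRank_le_one) (hmod : hasEntireLFunction_rat)
    (hr : W.analyticRank = 0) :
    MissingLowerBoundAt W p ↔
      (padicValNat p (Nat.card (P.A ⧸ (IwasawaAlgebra p) ∙ P.ι (Submodule.Quotient.mk y))) : ℤ) ≤
        ((PowerSeries.constantCoeff P.lam).valuation : ℤ) + padicValNat p (Nat.card (coinvariants p P.H2)) := by
  obtain ⟨q', hq', hv⟩ := exists_shaAn_eq_of_memberCountInputs C hGZK hmod hr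
  constructor
  · rintro ⟨q'', hq'', hle⟩
    have hqq : q'' = q' := by exact_mod_cast hq''.symm.trans hq'
    subst hqq
    rw [hv] at hle
    linarith
  · intro h
    exact ⟨q', hq', by rw [hv]; linarith⟩

/-- **The UPPER half at `W` holds unconditionally given the packages** (the hull descent is proved):
restated here from the index inequality for symmetry.  Kernel; nothing asserted.
[cite: Kato2004Asterisque, Thm. 14.5 (3) (p. 236), §14.14–Lemma 14.15 (pp. 243–244)] -/
theorem missingUpperBoundAt_of_memberCountInputs_member (C : MemberCountInputs W p κ γ I y P)
    (hGZK : rank_eq_analyticRank_of_analyticRank_le_one) (hmod : hasEntireLFunction_rat)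
    (hr : W.analyticRank = 0) : MissingUpperBoundAt W p := by
  obtain ⟨q', hq', hv⟩ := exists_shaAn_eq_of_memberCountInputs C hGZK hmod hr
  have hhull : ((PowerSeries.constantCoeff P.lam).valuation : ℤ) +
      (padicValNat p (Nat.card (coinvariants p P.H2)) : ℤ) ≤
      (padicValNat p (Nat.card (P.A ⧸ (IwasawaAlgebra p) ∙ P.ι (Submodule.Quotient.mk y))) : ℤ) := by
    exact_mod_cast P.valuation_add_padicValNat_coinvariants_le
  exact ⟨q', hq', by rw [hv]; linarith⟩

end Member

/-- **CLASS FORM — on every reducible additive potentially good row of analytic rank `0`, `BSD(E,p)` and its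
lower half are ONE pinned index (in)equality at Kato's member.**  Granted `nonempty_iwasawaH1Data`,
`exists_isNewformOf`, `exists_memberHullCountInputs` and Cassels / GZK / modularity: for `W/ℚ` globally
minimal, `p ≠ 2` additive potentially good, `W[p]` reducible, `r_an = 0`, there are Kato's member `W' ∼ W`
(globally minimal), a cyclotomic `κ`, `γ`, the pinned `I : IwasawaH1Data W' p κ γ`, the pinned class `𝐲`
and packages `P`, `C` with `MissingPPartAt W p ↔ (vλ(0) + ord #(𝐇²/X𝐇²) = ord[A:Λιȳ])` and
`MissingLowerBoundAt W p ↔ (ord[A:Λιȳ] ≤ vλ(0) + ord #(𝐇²/X𝐇²))` (Cassels transports both halves along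
`W ∼ W'`).  Conditional; nothing asserted; Conj. 12.10 (which gives the identity) is neither stated nor used.
[cite: Kato2004Asterisque, Conj. 12.10 (p. 224), §14.14–Lemma 14.15 (pp. 243–244), proof of Prop. 14.16 (pp. 244–245)]
[cite: Cassels1965ArithmeticVIII] [cite: Miller2011LMS, Def. 1.1] -/
theorem exists_member_missingPPartAt_iff_index_eq (hne : Kato2004.nonempty_iwasawaH1Data)
    (hmod : exists_isNewformOf) (hin : Kato2004.exists_memberHullCountInputs)
    (hCassels : bsdRHS_eq_of_isIsogenous) (hGZK : rank_eq_analyticRank_of_analyticRank_le_one)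
    (hmodL : hasEntireLFunction_rat)
    (W : WeierstrassCurve ℚ) [W.IsElliptic] [W.IsGloballyMinimal] (p : ℕ) [Fact p.Prime]
    (hp : p ≠ 2) (hng : ¬ W.HasGoodReductionAtPrime p) (hnm : ¬ W.HasMultiplicativeReductionAtPrime p)
    (hj : 0 ≤ padicValRat p W.j) (hred : ¬ W.HasIrreducibleModPGaloisRep p)
    (hr : W.analyticRank = 0) :
    ∃ (W' : WeierstrassCurve ℚ) (_ : W'.IsElliptic) (_ : W'.IsGloballyMinimal)
      (_ : ContinuousSMul ℤ_[p] (W'.tateModule p)) (κ : ZpExtension ℚ p) (γ : Field.absoluteGaloisGroup ℚ)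
      (I : IwasawaH1Data W' p κ γ) (y : I.H) (P : MemberHullInputs W' p κ γ I y)
      (_ : MemberCountInputs W' p κ γ I y P),
      IsIsogenous W W' ∧
      (MissingPPartAt W p ↔
        ((PowerSeries.constantCoeff P.lam).valuation : ℤ) + padicValNat p (Nat.card (coinvariants p P.H2)) =
          padicValNat p (Nat.card (P.A ⧸ (IwasawaAlgebra p) ∙ P.ι (Submodule.Quotient.mk y)))) ∧
      (MissingLowerBoundAt W p ↔
        (padicValNat p (Nat.card (P.A ⧸ (IwasawaAlgebra p) ∙ P.ι (Submodule.Quotient.mk y))) : ℤ) ≤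
          ((PowerSeries.constantCoeff P.lam).valuation : ℤ) +
            padicValNat p (Nat.card (coinvariants p P.H2))) := by
  have hL : W.entireLFunction 1 ≠ 0 := (W.analyticRank_eq_zero_iff_holds (hmodL W)).mp hr
  have hfin : Finite W.sha := (hGZK W (by rw [hr]; exact zero_le_one)).2
  -- Kato's member `W'` and the fact's data at it
  obtain ⟨W', hE', hM', hiso, hrest⟩ := hin W p hp hng hnm hj hred hL hfin
  haveI := hE'
  haveI := hM'
  haveI hcs : ContinuousSMul ℤ_[p] (W'.tateModule p) := TateModule.continuousSMul_padicInt
  haveI : Module.Free ℤ_[p] (W'.tateModule p) := W'.module_free_tateModule_holds p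
  haveI : Module.Finite ℤ_[p] (W'.tateModule p) := W'.module_finite_tateModule_holds p
  haveI : NeZero (W.conductorNorm ℤ) := ⟨(W.conductorNorm_pos_holds).ne'⟩
  obtain ⟨f, hf⟩ := hmod W
  obtain ⟨κ', Λ', c, d, a, A, z, x, -, -, -, -, hbody, hpack⟩ :=
    hrest f hf (fun m => Classical.arbitrary _)
  obtain ⟨κ, hκ, γ, hγ, -⟩ := exists_isCyclotomic_isTopGenerator_isCyclotomicVariable_holds p
  obtain ⟨I⟩ := hne W' p κ γ hκ hγ
  obtain ⟨y, hy⟩ :=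
    (IwasawaH1Data.existsUnique_lift_of_zetaBody p W' hκ hp I f _ κ' Λ' c d a A z x hbody).exists
  obtain ⟨P, ⟨C⟩⟩ := hpack κ γ hκ hγ I y hy
  have hr' : W'.analyticRank = 0 := by rw [← analyticRank_eq_of_isIsogenous' hiso, hr]
  have h1 := missingPPartAt_iff_index_eq C hGZK hmodL hr'
  have h2 := missingLowerBoundAt_iff_index_le C hGZK hmodL hr'
  refine ⟨W', hE', hM', hcs, κ, γ, I, y, P, C, hiso, ?_, ?_⟩
  · rw [← h1]
    constructor
    · exact fun h ↦ missingPPartAt_of_isIsogenous W W' p hCassels hGZK hmodL hiso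
        (by rw [hr]; exact zero_le_one) h
    · exact fun h ↦ missingPPartAt_of_isIsogenous W' W p hCassels hGZK hmodL
        hiso.symm_of_isElliptic (by rw [hr']; exact zero_le_one) h
  · rw [← h2]
    constructor
    · exact fun h ↦ TwistComparison.missingLowerBoundAt_of_isIsogenous W W' p hCassels hGZK hmodL hiso
        (by rw [hr]; exact zero_le_one) h
    · exact fun h ↦ TwistComparison.missingLowerBoundAt_of_isIsogenous W' W p hCassels hGZK hmodL
        hiso.symm_of_isElliptic (by rw [hr']; exact zero_le_one) h

end Summit.BirchSwinnertonDyer.BirchSwinnertonDyer.Theorems.ReducibleBSDOfCountInputs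

end
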